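import Mathlib.Geometry.Manifold.SmoothEmbedding
import Mathlib.Geometry.Manifold.Diffeomorph
import Mathlib.Geometry.Manifold.Instances.Sphere
import Mathlib.AlgebraicTopology.FundamentalGroupoid.SimplyConnected
import Literature.Topology.FourManifolds.SmoothOrientation
import HarnessLib

-- provenance: harness21/H21/H21/Prelude/FourManM/ConnectedSum.lean @ bdb687b (interim HEAD d8f2665); M5 mechanical rewrite
/-!
# Connected sums and open gluings of smooth manifolds (trunk T-4MAN, prelude `FourManM`)

This file provides the *relational* description of gluing constructions of smooth manifolds used
throughout the `FourManM` prelude (outline `H21/Outlines/FourManM.md`, §1 Design 3 and §2 C6), and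
its first instance, the connected sum.

* `Literature.IsOpenGluing IA IB IP R`: the manifold `P` is obtained by gluing the manifolds `A` and `B`
  along the relation `R : A → B → Prop`: there are open smooth embeddings `jA : A → P`,
  `jB : B → P` whose ranges cover `P` and such that `jA a = jB b ↔ R a b`. This is the universal
  property-free ("a posteriori") description of the pushout `A ∪_R B`; existence and uniqueness up
  to diffeomorphism of such a `P` are theorems, to be proved by construction in the L wave
  (`gluing_along_boundary`). The same predicate is reused for mapping tori, Dehn surgery and Gluck
  twists.
* `Literature.Topology.FourManifolds.IsOpenGluing.of_diffeomorph IA IB IP IP' A B P P'`: the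
  transportability predicate "open gluings of `A`, `B` into `(P, IP)` transport along every
  diffeomorphism `P ≃ₘ⟮IP, IP'⟯ P'`" — a parametrised predicate on the models, NOT a named fact
  (its closure over all model pairs is refuted; see "Retired named fact" below).
* `Literature.connectedSumRel i₁ i₂`: Kervaire–Milnor's gluing relation for the connected sum: given
  embeddings `i₁ : E → M`, `i₂ : E → N` of the model vector space ("open discs"), the point
  `i₁ (t • u)` of `M ∖ {i₁ 0}` is identified with `i₂ ((1 - t) • u)` of `N ∖ {i₂ 0}` for every unit
  vector `u` and `0 < t < 1` (Kervaire–Milnor, *Groups of homotopy spheres I*, Ann. of Math. 77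
  (1963), §2).
* `Literature.IsConnectedSum IP IM IN M N P`: `P` is *a* connected sum `M # N`, i.e. an open gluing of
  `M ∖ {i₁ 0}` and `N ∖ {i₂ 0}` along `connectedSumRel i₁ i₂` for some smooth disc embeddings
  `i₁`, `i₂`. Argument order (fixed for all consumers): models `IP IM IN`, then types `M N P`.
  The discs are modelled on the model vector space `EP` of `P`, while `M` and `N` may have arbitrary
  real models (so that e.g. `M # (𝕊² × 𝕊²)` with `N` modelled on `(𝓡 2).prod (𝓡 2)` typechecks).
* `Literature.SmoothOrientation.restrict o U`: restriction of a smooth orientation to an open subset.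
* `Literature.IsOrientedConnectedSum oM oN oP`: oriented connected sum: additionally `i₁` preserves and
  `i₂` reverses orientation (with respect to a constant orientation of the disc) and the gluing maps
  `jA`, `jB` are orientation preserving; then `P` is well defined up to orientation-preserving
  diffeomorphism (Kervaire–Milnor 1963, Lemma 2.1).

## Main statements (sorried, known results)

* `Literature.Topology.FourManifolds.exists_isConnectedSum`: two nonempty closed smooth `n`-manifolds have a connected sum which
  is a closed smooth `n`-manifold (Kervaire–Milnor 1963 §2; Kosinski, *Differential Manifolds*,
  VI.1).
* `Literature.Topology.FourManifolds.nonempty_diffeomorph_of_isOrientedConnectedSum`: the oriented connected sum of connected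
  oriented manifolds is unique up to diffeomorphism (Palais 1960 / Cerf 1961 disc theorem;
  Kervaire–Milnor 1963, Lemma 2.1; Kosinski VI.1.1).
* `Literature.Topology.FourManifolds.isConnectedSum_sphere_self`: `M` is a connected sum `M # 𝕊ⁿ` (Kosinski VI.1.3).
* `Literature.Topology.FourManifolds.IsConnectedSum.compactSpace`, `.connectedSpace`, `.simplyConnectedSpace`: `M # N` is compact,
  connected (dimension `≥ 2`), simply connected (dimension `≥ 3`) when `M` and `N` are.

Real (proved) API: `IsOpenGluing.symm`, `connectedSumRel_swap`, `IsConnectedSum.symm`,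
`isConnectedSum_comm`, `IsOrientedConnectedSum.isConnectedSum`, `IsOrientedConnectedSum.neg`.
The uniqueness theorems assume the common model space finite-dimensional, as in the sources.

**Retired named fact (defact verdict clean-up, 2026-08-15).** `IsOpenGluing.of_diffeomorph`
(transport of open gluings along diffeomorphisms `P ≃ₘ⟮IP, IP'⟯ P'`) was vendored as a *closed*
named fact attributed to Kosinski, Ch. VI §1, quantifying over two *arbitrary* models with corners
`IP`, `IP'` on `EP`. That claim is mis-stated (the source works with the one standard model
`ℝᵐ` / `ℝᵐ₊`, I.(1.1)) and **refuted** in the tree: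
`OpenGluingCounterexample.not_isOpenGluing_of_diffeomorph` (file `OpenGluingCounterexample.lean`,
which imports this one) disproves its instance for the models `{x² ≤ y}` and `{0 ≤ y}` of `ℝ²`.
The declaration is therefore no longer a named fact: it keeps its name and its body verbatim (so
the refutation and its in-tree users, which pass all arguments by name, typecheck unchanged) but
the models `IA IB IP IP'` and the types `A B P P'` are now explicit parameters written on the
declaration, i.e. it is the parametrised *predicate*
`IsOpenGluing.of_diffeomorph IA IB IP IP' A B P P'` ("open gluings with pieces `A`, `B` transport
from `(P, IP)` to `(P', IP')` along every diffeomorphism"), true for some model pairs and false for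
others. The corrected transport statement — hypothesis `range IP' = range IP` (in particular
`IP' = IP`, or both models boundaryless) — is the theorem `IsOpenGluing.of_diffeomorph_of_range_eq`
(dot-notation form `IsOpenGluing.diffeomorph_comp`) of the sibling file
`ConnectedSumTransportProofs.lean`, which also proves the true instances of the predicate
(`IsOpenGluing.of_diffeomorph_holds_of_range_eq`, `…_holds_self`, `…_holds_of_boundaryless`).

## Mathlib status and design choices

* Mathlib has smooth embeddings (`Manifold.IsSmoothEmbedding`, no composition lemma yet: `comp` and
  `Diffeomorph.isSmoothEmbedding` are `proof_wanted`), diffeomorphisms, the manifold structure on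
  open subsets (`TopologicalSpace.Opens.instChartedSpace`, `chartAt_subtype_val_symm_eventuallyEq`)
  and on spheres, but **no** connected sum, pushout or gluing of manifolds
  (`rg -i 'connected sum|ConnectedSum|gluing' Mathlib/Geometry Mathlib/Topology`: nothing relevant).
* Following outline Design 3 the pieces `A = M ∖ {i₁ 0}`, `B = N ∖ {i₂ 0}` are `Opens` of `M`, `N`,
  which already carry Mathlib's `ChartedSpace`/`IsManifold` instances; no quotient type is built.
* `SmoothOrientation.restrict` needs the fact that the tangent coordinate changes of an open
  submanifold `U ⊆ M` are those of `M` (`TopologicalSpace.Opens.tangentCoordChange_coe`),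
  proved here from `OpenPartialHomeomorph.subtypeRestr_symm_eqOn`.
* `IsConnectedSum.connectedSpace` assumes dimension `≥ 2` (`ℝ # ℝ` is two lines) and
  `simplyConnectedSpace` dimension `≥ 3`; `isConnectedSum_sphere_self` is stated only for `M`
  modelled on `𝓡 n` (review #14 of the outline), where it is meaningful and true.

Sources: M. Kervaire, J. Milnor, *Groups of homotopy spheres I*, Ann. of Math. 77 (1963), §2;
A. Kosinski, *Differential Manifolds* (1993), Ch. VI §1; R. Palais, *Extending diffeomorphisms*,
Proc. AMS 11 (1960); outline `H21/Outlines/FourManM.md` §1 (Design 3), §2 (C6), review #14.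
-/

open scoped Manifold ContDiff Topology
open Set Module

noncomputable section

namespace Literature.Topology.FourManifolds

/-- Local notation: `𝔼 n` is the model Euclidean space `EuclideanSpace ℝ (Fin n)`. -/
local notation "𝔼 " n:arg => EuclideanSpace ℝ (Fin n)

/-- Local notation: `𝕊 n` is the unit sphere in `EuclideanSpace ℝ (Fin (n + 1))`, the standard
`n`-sphere with its Mathlib analytic manifold structure. -/
local notation "𝕊 " n:arg => (Metric.sphere (0 : EuclideanSpace ℝ (Fin (n + 1))) 1)

/-! ### Open gluings -/

section Gluing

variable {EA HA EB HB EP HP : Type*}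
  [NormedAddCommGroup EA] [NormedSpace ℝ EA] [TopologicalSpace HA] (IA : ModelWithCorners ℝ EA HA)
  [NormedAddCommGroup EB] [NormedSpace ℝ EB] [TopologicalSpace HB] (IB : ModelWithCorners ℝ EB HB)
  [NormedAddCommGroup EP] [NormedSpace ℝ EP] [TopologicalSpace HP] (IP : ModelWithCorners ℝ EP HP)
  {A B P : Type*} [TopologicalSpace A] [ChartedSpace HA A] [TopologicalSpace B]
  [ChartedSpace HB B] [TopologicalSpace P] [ChartedSpace HP P]

/-- **Open gluing.** The manifold `P` is obtained by gluing the manifolds `A` and `B` along the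
relation `R : A → B → Prop`: there exist smooth (`C^∞`) embeddings `jA : A → P`, `jB : B → P` with
open ranges covering `P`, such that `jA a = jB b` holds exactly when `R a b`. Thus `P` is, as a
set, the pushout of `A ← {(a, b) | R a b} → B`, its topology and smooth structure being determined
by the requirement that `jA`, `jB` be open smooth embeddings. This is the standard description of
"`P = A ∪ B` glued along a diffeomorphism of open subsets" (Kervaire–Milnor, *Groups of homotopy
spheres I* (1963), §2; Kosinski, *Differential Manifolds*, VI.1 and I.(5.1); outline Design 3).
No `IsManifold` hypothesis is imposed on `A`, `B`, `P` (only `ChartedSpace`; smoothness of `jA`,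
`jB` refers to the maximal atlases): as for `Cobordism` in Design 3, every consumer adds the
`IsManifold … ∞` hypotheses it needs. [folklore] -/
def IsOpenGluing (R : A → B → Prop) : Prop :=
  ∃ (jA : A → P) (jB : B → P),
    Manifold.IsSmoothEmbedding IA IP ∞ jA ∧ IsOpen (range jA) ∧
    Manifold.IsSmoothEmbedding IB IP ∞ jB ∧ IsOpen (range jB) ∧
    range jA ∪ range jB = univ ∧ ∀ a b, jA a = jB b ↔ R a b

variable {IA IB IP}

/-- An open gluing of `A` and `B` along `R` is an open gluing of `B` and `A` along the swapped
relation (Kosinski, *Differential Manifolds*, VI.1). [folklore] -/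
theorem IsOpenGluing.symm {R : A → B → Prop} (h : IsOpenGluing IA IB IP (P := P) R) :
    IsOpenGluing IB IA IP (P := P) (Function.swap R) := by
  obtain ⟨jA, jB, hA, hAo, hB, hBo, hU, hR⟩ := h
  refine ⟨jB, jA, hB, hBo, hA, hAo, (union_comm _ _).trans hU, fun b a => ?_⟩
  rw [eq_comm]
  exact hR a b

end Gluing

/-! ### Transportability of open gluings along diffeomorphisms (a predicate; retired named fact) -/

section GluingTransport

variable {EA HA EB HB EP HP HP' : Type*}
  [NormedAddCommGroup EA] [NormedSpace ℝ EA] [TopologicalSpace HA]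
  [NormedAddCommGroup EB] [NormedSpace ℝ EB] [TopologicalSpace HB]
  [NormedAddCommGroup EP] [NormedSpace ℝ EP] [TopologicalSpace HP] [TopologicalSpace HP']

/-- **Transportability of open gluings along diffeomorphisms** — a parametrised *predicate* on
the models and spaces, NOT a named fact. `IsOpenGluing.of_diffeomorph IA IB IP IP' A B P P'`
says: whenever `P`, `P'` are `C^∞` manifolds for `IP`, `IP'`, every open gluing
`IsOpenGluing IA IB IP (P := P) R` of the pieces `A`, `B` is carried by every diffeomorphism
`e : P ≃ₘ⟮IP, IP'⟯ P'` to an open gluing `IsOpenGluing IA IB IP' (P := P') R` (compose the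
gluing embeddings `jA`, `jB` with `e`). Of the two instance hypotheses in the body only
`[IsManifold IP' ∞ P']` matters (smooth embeddings refer to the maximal `C^∞` atlas of the
target); `[IsManifold IP ∞ P]` is superfluous and kept only for compatibility. Argument order as
for `IsConnectedSum`: models `IA IB IP IP'`, then types `A B P P'` (all binders deliberately
written on the declaration, not in a `variable` line).

**History and status (defact verdict clean-up, 2026-08-15).** This declaration was vendored as a
*closed* named fact citing Kosinski (1993), Ch. VI §1, i.e. as the claim that the transport
holds for ALL pairs of models with corners `IP`, `IP'` on `EP`. That claim is **mis-stated and
refuted**, and the def is retired as literature debt: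
* *Refutation (kept):* `OpenGluingCounterexample.not_isOpenGluing_of_diffeomorph` (file
  `OpenGluingCounterexample.lean`, which imports this one, so it cannot be named in Lean here)
  proves `¬ IsOpenGluing.of_diffeomorph modelParab modelParab modelParab modelHalf Parab Parab
  Parab Half` for the inclusion models of the parabola region `Parab = {x² ≤ y}` and the
  half-plane `Half = {0 ≤ y}` in `ℝ²` (gluing of `Parab` with itself along `Eq`, transported
  along the shear `(x, y) ↦ (x, y - x²) : Parab ≃ₘ Half`): Mathlib's immersions are *linear*
  in charts of the maximal atlases, so the germs of `range IP` and `range IP'` at corresponding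
  points must be linearly equivalent, whereas a diffeomorphism between differently modelled
  manifolds identifies them only by a homeomorphism smooth *within* these sets.
* *What the source says:* Kosinski, *Differential Manifolds* (1993) models every manifold on the
  one standard model `ℝᵐ` / `ℝᵐ₊` (Ch. I, (1.1)) and proves that the smooth structure of a
  gluing is the unique one for which the projections of the pieces are diffeomorphisms onto
  open subsets (Ch. VI §1, proof of Thm (1.1), (∗)) — a property that diffeomorphisms between
  *equally modelled* manifolds do transport. Two unrelated `ModelWithCorners` on one vector
  space are a formalisation artefact the source never considers.
* *Corrected statement (proved):* with the necessary hypothesis `range IP' = range IP` (in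
  particular `IP' = IP`, or both models boundaryless) the transport is the theorem
  `IsOpenGluing.of_diffeomorph_of_range_eq` (dot-notation form `IsOpenGluing.diffeomorph_comp`)
  of the sibling file `ConnectedSumTransportProofs.lean`.
* *True instances of this predicate (proved, same sibling file):*
  `IsOpenGluing.of_diffeomorph_holds_of_range_eq`, `…_holds_self`, `…_holds_of_boundaryless`;
  they feed the consumers that carry the predicate as a hypothesis for a fixed pair of models
  (e.g. `IsIntegralSurgery.of_diffeomorph` in `DehnSurgery.lean`).
* *This declaration:* same name, body kept VERBATIM (so the refutation, the instances and the
  consumers above — which all pass their arguments by name — typecheck unchanged); only the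
  binders of the models `IA IB IP IP'` and of the types `A B P P'` (with their instances) moved
  from the `variable` line onto the declaration as explicit parameters, which makes it
  syntactically the predicate it always was semantically. It admits no `_holds` discharge and
  must not be cited as a published result; the lemma-style name is historical.
[folklore] -/
def IsOpenGluing.of_diffeomorph (IA : ModelWithCorners ℝ EA HA) (IB : ModelWithCorners ℝ EB HB)
    (IP : ModelWithCorners ℝ EP HP) (IP' : ModelWithCorners ℝ EP HP')
    (A B P P' : Type*) [TopologicalSpace A] [ChartedSpace HA A] [TopologicalSpace B]
    [ChartedSpace HB B] [TopologicalSpace P] [ChartedSpace HP P] [TopologicalSpace P']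
    [ChartedSpace HP' P'] : Prop :=
  ∀ [IsManifold IP ∞ P] [IsManifold IP' ∞ P'] {R : A → B → Prop} (h : IsOpenGluing IA IB IP (P := P) R) (e : P ≃ₘ⟮IP, IP'⟯ P'),
    IsOpenGluing IA IB IP' (P := P') R

/-- Unfolding of the transportability predicate `IsOpenGluing.of_diffeomorph` (its body, for
consumers that want the `∀` form without delta-reduction) (Kosinski, *Differential Manifolds*,
VI.1, for the meaning of the transport). [folklore] -/
theorem IsOpenGluing.of_diffeomorph_iff (IA : ModelWithCorners ℝ EA HA)
    (IB : ModelWithCorners ℝ EB HB) (IP : ModelWithCorners ℝ EP HP)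
    (IP' : ModelWithCorners ℝ EP HP') (A B P P' : Type*) [TopologicalSpace A] [ChartedSpace HA A]
    [TopologicalSpace B] [ChartedSpace HB B] [TopologicalSpace P] [ChartedSpace HP P]
    [TopologicalSpace P'] [ChartedSpace HP' P'] :
    IsOpenGluing.of_diffeomorph IA IB IP IP' A B P P' ↔
      ∀ [IsManifold IP ∞ P] [IsManifold IP' ∞ P'] {R : A → B → Prop},
        IsOpenGluing IA IB IP (P := P) R → (P ≃ₘ⟮IP, IP'⟯ P') →
          IsOpenGluing IA IB IP' (P := P') R :=
  Iff.rfl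

end GluingTransport

/-! ### The connected sum relation -/

section ConnectedSum

variable {EP : Type*} [NormedAddCommGroup EP] [NormedSpace ℝ EP] {M N : Type*}

/-- **Kervaire–Milnor's connected sum relation.** Given maps ("disc embeddings") `i₁ : EP → M`,
`i₂ : EP → N` of a real normed space, the point `a` of `M ∖ {i₁ 0}` is related to the point `b` of
`N ∖ {i₂ 0}` iff `a = i₁ (t • u)` and `b = i₂ ((1 - t) • u)` for some unit vector `u` and some
`t ∈ (0, 1)`: the punctured open discs are identified along the orientation-reversing (for `i₁`,
`i₂` both orientation preserving) inversion `t • u ↦ (1 - t) • u`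
(Kervaire–Milnor, *Groups of homotopy spheres I*, Ann. of Math. 77 (1963), §2, p. 505). [folklore] -/
def connectedSumRel (i₁ : EP → M) (i₂ : EP → N) (a : ↥({i₁ 0}ᶜ : Set M))
    (b : ↥({i₂ 0}ᶜ : Set N)) : Prop :=
  ∃ (u : EP) (t : ℝ),
    ‖u‖ = 1 ∧ t ∈ Ioo (0 : ℝ) 1 ∧ (a : M) = i₁ (t • u) ∧ (b : N) = i₂ ((1 - t) • u)

/-- The connected sum relation is symmetric under exchanging the two discs: substitute
`t ↦ 1 - t` (Kervaire–Milnor 1963, §2). [cite: KervaireMilnor1963, §2] -/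
theorem connectedSumRel_swap (i₁ : EP → M) (i₂ : EP → N) :
    Function.swap (connectedSumRel i₁ i₂) = connectedSumRel i₂ i₁ := by
  funext b a
  apply propext
  constructor
  · rintro ⟨u, t, hu, ht, ha, hb⟩
    refine ⟨u, 1 - t, hu, ⟨by linarith [ht.2], by linarith [ht.1]⟩, hb, ?_⟩
    rwa [sub_sub_cancel]
  · rintro ⟨u, t, hu, ht, hb, ha⟩
    refine ⟨u, 1 - t, hu, ⟨by linarith [ht.2], by linarith [ht.1]⟩, ha, ?_⟩
    rwa [sub_sub_cancel]

end ConnectedSum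

section Puncture

variable {X : Type*} [Zero X] {M : Type*} [TopologicalSpace M] [T1Space M]

/-- The open piece `M ∖ {i 0}` of `M` glued in a connected sum along a disc `i : X → M`, as an
open subset of `M` (points of `M` are closed); it carries Mathlib's open-submanifold structure
(Kervaire–Milnor 1963, §2). [cite: KervaireMilnor1963, §2] -/
def puncture (i : X → M) : TopologicalSpace.Opens M := ⟨{i 0}ᶜ, isOpen_compl_singleton⟩

/-- The carrier of `puncture i` is `{i 0}ᶜ`, definitionally (Kervaire–Milnor 1963, §2). [cite: KervaireMilnor1963, §2] -/
@[simp] theorem coe_puncture (i : X → M) : (puncture i : Set M) = {i 0}ᶜ := rfl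

/-- Membership in the punctured piece: `a ∈ puncture i ↔ a ≠ i 0` (Kervaire–Milnor 1963, §2). [cite: KervaireMilnor1963, §2] -/
@[simp] theorem mem_puncture {i : X → M} {a : M} : a ∈ puncture i ↔ a ≠ i 0 := Iff.rfl

end Puncture

section ConnectedSum

variable {EP HP : Type*} [NormedAddCommGroup EP] [NormedSpace ℝ EP] [TopologicalSpace HP]

/-- **Connected sum** (relational form). `IsConnectedSum IP IM IN M N P` says that the manifold `P`
(modelled on `IP : ModelWithCorners ℝ EP HP`) is a connected sum `M # N`: there are smooth
embeddings `i₁ : EP → M`, `i₂ : EP → N` of the model vector space of `P` ("open discs") such that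
`P` is the open gluing of `M ∖ {i₁ 0}` and `N ∖ {i₂ 0}` along Kervaire–Milnor's relation
`i₁ (t • u) ∼ i₂ ((1 - t) • u)`, `‖u‖ = 1`, `0 < t < 1`. Argument order: models `IP IM IN`, then
types `M N P`. `M` and `N` may have arbitrary real models; `M`, `N` are Hausdorff so that the
punctured pieces are open. No connectedness or orientation data are recorded here, so `P` is in
general not unique (see `IsOrientedConnectedSum`). As for `IsOpenGluing`, no `IsManifold`
hypothesis is imposed on `M`, `N`, `P`; consumers add `IsManifold … ∞` as needed.
This is a *definition* (a predicate in `IP IM IN M N P`, whose binders are deliberately written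
on the declaration rather than in a `variable` line), not a closed named fact: its universal
closure is false, since `IsConnectedSum.nonempty` forces `P` to be nonempty
(Kervaire–Milnor, *Groups of homotopy spheres I* (1963), §2; Kosinski, *Differential Manifolds*,
VI.1). [folklore] -/
def IsConnectedSum (IP : ModelWithCorners ℝ EP HP)
    {EM HM : Type*} [NormedAddCommGroup EM] [NormedSpace ℝ EM] [TopologicalSpace HM]
    (IM : ModelWithCorners ℝ EM HM)
    {EN HN : Type*} [NormedAddCommGroup EN] [NormedSpace ℝ EN] [TopologicalSpace HN]
    (IN : ModelWithCorners ℝ EN HN)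
    (M N P : Type*) [TopologicalSpace M] [T2Space M] [ChartedSpace HM M]
    [TopologicalSpace N] [T2Space N] [ChartedSpace HN N] [TopologicalSpace P] [ChartedSpace HP P] :
    Prop :=
  ∃ (i₁ : EP → M) (i₂ : EP → N),
    Manifold.IsSmoothEmbedding 𝓘(ℝ, EP) IM ∞ i₁ ∧ Manifold.IsSmoothEmbedding 𝓘(ℝ, EP) IN ∞ i₂ ∧
    IsOpenGluing IM IN IP (A := puncture i₁) (B := puncture i₂) (P := P) (connectedSumRel i₁ i₂)

variable {IP : ModelWithCorners ℝ EP HP}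
  {EM HM : Type*} [NormedAddCommGroup EM] [NormedSpace ℝ EM] [TopologicalSpace HM]
  {IM : ModelWithCorners ℝ EM HM}
  {EN HN : Type*} [NormedAddCommGroup EN] [NormedSpace ℝ EN] [TopologicalSpace HN]
  {IN : ModelWithCorners ℝ EN HN}
  {M N P : Type*} [TopologicalSpace M] [T2Space M] [ChartedSpace HM M]
  [TopologicalSpace N] [T2Space N] [ChartedSpace HN N] [TopologicalSpace P] [ChartedSpace HP P]

/-- The connected sum is symmetric: `P` is a connected sum `M # N` iff it is a connected sum
`N # M` (swap the discs and substitute `t ↦ 1 - t`; Kervaire–Milnor 1963, §2, "commutative"). [cite: KervaireMilnor1963, §2  "commutative"] -/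
theorem IsConnectedSum.symm (h : IsConnectedSum IP IM IN M N P) :
    IsConnectedSum IP IN IM N M P := by
  obtain ⟨i₁, i₂, h₁, h₂, hG⟩ := h
  refine ⟨i₂, i₁, h₂, h₁, ?_⟩
  rw [← connectedSumRel_swap]
  exact hG.symm

/-- The connected sum is commutative: `P` is a connected sum `M # N` iff it is a connected sum
`N # M` (Kervaire–Milnor 1963, §2, "commutative"; both directions are `IsConnectedSum.symm`). [cite: KervaireMilnor1963, §2  "commutative"] -/
theorem isConnectedSum_comm : IsConnectedSum IP IM IN M N P ↔ IsConnectedSum IP IN IM N M P :=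
  ⟨IsConnectedSum.symm, IsConnectedSum.symm⟩

/-- Unfolding of `IsConnectedSum` (Kervaire–Milnor 1963, §2). [cite: KervaireMilnor1963, §2] -/
theorem isConnectedSum_iff : IsConnectedSum IP IM IN M N P ↔
    ∃ (i₁ : EP → M) (i₂ : EP → N),
      Manifold.IsSmoothEmbedding 𝓘(ℝ, EP) IM ∞ i₁ ∧ Manifold.IsSmoothEmbedding 𝓘(ℝ, EP) IN ∞ i₂ ∧
      IsOpenGluing IM IN IP (A := puncture i₁) (B := puncture i₂) (P := P)
        (connectedSumRel i₁ i₂) :=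
  Iff.rfl

end ConnectedSum

/-! ### Restriction of orientations to open subsets -/

section Restrict

variable {E H : Type*} [NormedAddCommGroup E] [NormedSpace ℝ E] [TopologicalSpace H]
  {I : ModelWithCorners ℝ E H} {M : Type*} [TopologicalSpace M] [ChartedSpace H M]
  [IsManifold I 1 M]

/-- The tangent coordinate changes of an open submanifold `U ⊆ M` (whose charts are the
restrictions `(chartAt H x.1).subtypeRestr` of the charts of `M`) agree with those of `M` at every
point of the source of the first chart (elsewhere both sides are junk values which may differ)
(Kosinski, *Differential Manifolds*, I.2; Mathlib `TopologicalSpace.Opens.instChartedSpace`). [folklore] -/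
theorem TopologicalSpace.Opens.tangentCoordChange_coe (U : TopologicalSpace.Opens M) {x y z : U}
    (hz : z ∈ (chartAt H x).source) :
    tangentCoordChange I x y z = tangentCoordChange I (x : M) (y : M) (z : M) := by
  rw [tangentCoordChange_def, tangentCoordChange_def]
  have hz' : (z : M) ∈ (chartAt H (x : M)).source := by
    simpa only [TopologicalSpace.Opens.chartAt_eq, OpenPartialHomeomorph.subtypeRestr_source,
      mem_preimage] using hz
  have h1 : extChartAt I x z = extChartAt I (x : M) (z : M) := rfl
  rw [h1]
  apply Filter.EventuallyEq.fderivWithin_eq_of_nhds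
  -- the two coordinate changes agree near `extChartAt I x z`
  set e := chartAt H (x : M) with he
  have hU : Nonempty U := ⟨x⟩
  have htgt : (e.subtypeRestr hU).target ∈ 𝓝 (e z) :=
    (e.subtypeRestr hU).open_target.mem_nhds (e.map_subtype_source hU hz')
  have hpre : I.symm ⁻¹' (e.subtypeRestr hU).target ∈ 𝓝 (extChartAt I (x : M) (z : M)) := by
    refine I.continuous_symm.continuousAt.preimage_mem_nhds ?_
    simpa only [extChartAt_coe, Function.comp_apply, I.left_inv] using htgt
  filter_upwards [hpre] with w hw
  simp only [Function.comp_apply, extChartAt_coe, extChartAt_coe_symm,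
    TopologicalSpace.Opens.chartAt_eq, OpenPartialHomeomorph.subtypeRestr_coe, restrict_apply]
  congr 2
  exact (e.subtypeRestr_symm_eqOn hU hw).symm

/-- **Restriction of a smooth orientation** to an open subset `U ⊆ M`: the orientation at `x : U`
is the orientation of `M` at `x`. Local constancy transfers because the charts of `U` are the
restricted charts of `M`, so the tangent coordinate changes agree
(`TopologicalSpace.Opens.tangentCoordChange_coe`) (Hirsch, *Differential Topology*, §4.4;
Kosinski, *Differential Manifolds*, I.2). [folklore] -/
def SmoothOrientation.restrict (o : SmoothOrientation I M) (U : TopologicalSpace.Opens M) :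
    SmoothOrientation I U where
  toFun x := o x
  eventually_eq_iff' x := by
    have h := (o.eventually_eq_iff (x : M))
    have hc : ∀ᶠ y in 𝓝 x, y ∈ (chartAt H y).source := Filter.Eventually.of_forall
      fun y => mem_chart_source H y
    filter_upwards [continuous_subtype_val.continuousAt.eventually h, hc] with y hy hy'
    rw [TopologicalSpace.Opens.tangentCoordChange_coe U hy']
    exact hy

/-- The restricted orientation at `x : U` is the orientation at `x : M` (Hirsch §4.4). [folklore] -/
@[simp] theorem SmoothOrientation.restrict_apply (o : SmoothOrientation I M)
    (U : TopologicalSpace.Opens M) (x : U) : o.restrict U x = o x := rfl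

/-- Restriction commutes with reversing the orientation (Hirsch §4.4). [folklore] -/
theorem SmoothOrientation.restrict_neg (o : SmoothOrientation I M)
    (U : TopologicalSpace.Opens M) : (-o).restrict U = -o.restrict U := rfl

end Restrict

/-! ### Oriented connected sums -/

section Oriented

variable {E HM HN HP : Type*} [NormedAddCommGroup E] [NormedSpace ℝ E]
  [TopologicalSpace HM] {IM : ModelWithCorners ℝ E HM}
  [TopologicalSpace HN] {IN : ModelWithCorners ℝ E HN}
  [TopologicalSpace HP] {IP : ModelWithCorners ℝ E HP}
  {M N P : Type*} [TopologicalSpace M] [T2Space M] [ChartedSpace HM M] [IsManifold IM 1 M]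
  [TopologicalSpace N] [T2Space N] [ChartedSpace HN N] [IsManifold IN 1 N]
  [TopologicalSpace P] [ChartedSpace HP P] [IsManifold IP 1 P]

/-- **Oriented connected sum** (relational form; all three manifolds modelled on the same vector
space `E`). `IsOrientedConnectedSum oM oN oP` says that the oriented manifold `(P, oP)` is the
oriented connected sum `(M, oM) # (N, oN)`: there are smooth disc embeddings `i₁ : E → M`,
`i₂ : E → N` and a constant orientation `o₀` of `E` such that `i₁` preserves and `i₂` reverses
orientation, and orientation-preserving open smooth embeddings `jA : M ∖ {i₁ 0} → P`,
`jB : N ∖ {i₂ 0} → P` (for the restricted orientations) exhibiting `P` as the open gluing along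
Kervaire–Milnor's relation `i₁ (t • u) ∼ i₂ ((1 - t) • u)`. Since the inversion
`t • u ↦ (1 - t) • u` of the punctured disc reverses orientation, `oP` restricts to `oM` and `oN`
on the two pieces (Kervaire–Milnor, *Groups of homotopy spheres I* (1963), §2, p. 505;
Kosinski, *Differential Manifolds*, VI.1). [folklore] -/
def IsOrientedConnectedSum (oM : SmoothOrientation IM M) (oN : SmoothOrientation IN N)
    (oP : SmoothOrientation IP P) : Prop :=
  ∃ (i₁ : E → M) (i₂ : E → N) (o₀ : Orientation ℝ E (Fin (finrank ℝ E)))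
    (jA : puncture i₁ → P) (jB : puncture i₂ → P),
    Manifold.IsSmoothEmbedding 𝓘(ℝ, E) IM ∞ i₁ ∧ Manifold.IsSmoothEmbedding 𝓘(ℝ, E) IN ∞ i₂ ∧
    IsOrientationPreserving (SmoothOrientation.modelSpace o₀) oM i₁ ∧
    IsOrientationReversing (SmoothOrientation.modelSpace o₀) oN i₂ ∧
    (Manifold.IsSmoothEmbedding IM IP ∞ jA ∧ IsOpen (range jA) ∧
      Manifold.IsSmoothEmbedding IN IP ∞ jB ∧ IsOpen (range jB) ∧
      range jA ∪ range jB = univ ∧ ∀ a b, jA a = jB b ↔ connectedSumRel i₁ i₂ a b) ∧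
    IsOrientationPreserving (oM.restrict (puncture i₁)) oP jA ∧
    IsOrientationPreserving (oN.restrict (puncture i₂)) oP jB

/-- An oriented connected sum is in particular a connected sum (forget the orientation data;
Kervaire–Milnor 1963, §2). [cite: KervaireMilnor1963, §2] -/
theorem IsOrientedConnectedSum.isConnectedSum {oM : SmoothOrientation IM M}
    {oN : SmoothOrientation IN N} {oP : SmoothOrientation IP P}
    (h : IsOrientedConnectedSum oM oN oP) : IsConnectedSum IP IM IN M N P := by
  obtain ⟨i₁, i₂, _, jA, jB, h₁, h₂, -, -, hG, -, -⟩ := h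
  exact ⟨i₁, i₂, h₁, h₂, jA, jB, hG⟩

/-- Reversing all three orientations preserves oriented connected sums:
`(-M) # (-N) = -(M # N)` (replace `o₀` by `-o₀`; Kervaire–Milnor 1963, §2). [cite: KervaireMilnor1963, §2] -/
theorem IsOrientedConnectedSum.neg {oM : SmoothOrientation IM M} {oN : SmoothOrientation IN N}
    {oP : SmoothOrientation IP P} (h : IsOrientedConnectedSum oM oN oP) :
    IsOrientedConnectedSum (-oM) (-oN) (-oP) := by
  obtain ⟨i₁, i₂, o₀, jA, jB, h₁, h₂, ho₁, ho₂, hG, hA, hB⟩ := h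
  refine ⟨i₁, i₂, -o₀, jA, jB, h₁, h₂, ?_, ?_, hG, ?_, ?_⟩
  · rwa [← SmoothOrientation.neg_modelSpace, isOrientationPreserving_neg_neg_iff]
  · rwa [IsOrientationReversing, ← SmoothOrientation.neg_modelSpace,
      isOrientationPreserving_neg_neg_iff]
  · rwa [SmoothOrientation.restrict_neg, isOrientationPreserving_neg_neg_iff]
  · rwa [SmoothOrientation.restrict_neg, isOrientationPreserving_neg_neg_iff]

end Oriented

/-! ### Existence and uniqueness (sorried, known results) -/

section Theorems

variable {E HM HN HP HP' : Type*} [NormedAddCommGroup E] [NormedSpace ℝ E] [FiniteDimensional ℝ E]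
  [TopologicalSpace HM] {IM : ModelWithCorners ℝ E HM}
  [TopologicalSpace HN] {IN : ModelWithCorners ℝ E HN}
  [TopologicalSpace HP] {IP : ModelWithCorners ℝ E HP}
  [TopologicalSpace HP'] {IP' : ModelWithCorners ℝ E HP'}
  {M N P P' : Type*} [TopologicalSpace M] [T2Space M] [ChartedSpace HM M] [IsManifold IM ∞ M]
  [TopologicalSpace N] [T2Space N] [ChartedSpace HN N] [IsManifold IN ∞ N]
  [TopologicalSpace P] [ChartedSpace HP P] [IsManifold IP ∞ P]
  [TopologicalSpace P'] [ChartedSpace HP' P'] [IsManifold IP' ∞ P']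

/-- **Uniqueness of the oriented connected sum** (Kervaire–Milnor, *Groups of homotopy spheres I*
(1963), Lemma 2.1; Kosinski, *Differential Manifolds*, VI.1.1). If `M` and `N` are connected and
oriented, any two oriented connected sums `P`, `P'` of `(M, oM)` and `(N, oN)` are diffeomorphic by
an orientation-preserving diffeomorphism. Proof in print: an open gluing is determined up to
diffeomorphism by `(A, B, R)`, and any two orientation-preserving smooth embeddings of a closed
disc into a connected oriented manifold are ambient isotopic (Palais, *Extending diffeomorphisms*
(1960), Thm B; Cerf 1961). No compactness is needed; `M`, `N` are genuine (Hausdorff, second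
countable) manifolds, and the common model vector space `E` is finite-dimensional, as in the cited
sources (in infinite dimensions the determinant-based orientation conditions degenerate). [cite: Cerf1961] -/
def exists_diffeomorph_isOrientationPreserving_of_isOrientedConnectedSum : Prop :=
  ∀ [SecondCountableTopology M] [ConnectedSpace M] [SecondCountableTopology N] [ConnectedSpace N] {oM : SmoothOrientation IM M} {oN : SmoothOrientation IN N} {oP : SmoothOrientation IP P} {oP' : SmoothOrientation IP' P'} (h : IsOrientedConnectedSum oM oN oP) (h' : IsOrientedConnectedSum oM oN oP'),
    ∃ e : P ≃ₘ⟮IP, IP'⟯ P', e.IsOrientationPreserving oP oP'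

/-- **Uniqueness of the oriented connected sum up to diffeomorphism**: two oriented connected sums
of the same connected oriented manifolds `M`, `N` are diffeomorphic (Kervaire–Milnor, *Groups of
homotopy spheres I* (1963), Lemma 2.1; Kosinski, *Differential Manifolds*, VI.1.1; corollary of
`exists_diffeomorph_isOrientationPreserving_of_isOrientedConnectedSum`). Without the orientation
conditions uniqueness fails in general (e.g. `ℂℙ² # ℂℙ²` versus `ℂℙ² # -ℂℙ²`). [folklore] -/
def nonempty_diffeomorph_of_isOrientedConnectedSum : Prop :=
  ∀ [SecondCountableTopology M] [ConnectedSpace M] [SecondCountableTopology N] [ConnectedSpace N] {oM : SmoothOrientation IM M} {oN : SmoothOrientation IN N} {oP : SmoothOrientation IP P} {oP' : SmoothOrientation IP' P'} (h : IsOrientedConnectedSum oM oN oP) (h' : IsOrientedConnectedSum oM oN oP'),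
    Nonempty (P ≃ₘ⟮IP, IP'⟯ P')

/- interim proof relied on results that are now named facts (D-0014); demoted to a fact by the M5 import, proof preserved:
:=
  (exists_diffeomorph_isOrientationPreserving_of_isOrientedConnectedSum h h').nonempty
-/

end Theorems

section Euclidean

universe u

variable {n : ℕ}

/-- **Existence of connected sums** (Kervaire–Milnor, *Groups of homotopy spheres I* (1963), §2;
Kosinski, *Differential Manifolds*, VI.1). Two nonempty closed (compact, Hausdorff, second
countable) smooth `n`-manifolds `M`, `N` have a connected sum `M # N` which is again a closed smooth
`n`-manifold: choose charts to obtain disc embeddings `i₁`, `i₂` and form the pushout of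
`M ∖ {i₁ 0}` and `N ∖ {i₂ 0}` along Kervaire–Milnor's relation (it is Hausdorff because the
centres of the discs are removed). Nonemptiness is needed for the discs to exist. [cite: Kosinski1993, Ch. VI §1] -/
def exists_isConnectedSum : Prop :=
  ∀ (M N : Type u) [TopologicalSpace M] [T2Space M] [SecondCountableTopology M] [ChartedSpace (𝔼 n) M] [IsManifold (𝓡 n) ∞ M] [CompactSpace M] [Nonempty M] [TopologicalSpace N] [T2Space N] [SecondCountableTopology N] [ChartedSpace (𝔼 n) N] [IsManifold (𝓡 n) ∞ N] [CompactSpace N] [Nonempty N],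
    ∃ (P : Type u) (_ : TopologicalSpace P) (_ : T2Space P) (_ : SecondCountableTopology P)
      (_ : ChartedSpace (𝔼 n) P) (_ : IsManifold (𝓡 n) ∞ P) (_ : CompactSpace P),
      IsConnectedSum (𝓡 n) (𝓡 n) (𝓡 n) M N P

/-- **Existence of oriented connected sums** in positive dimension (Kervaire–Milnor 1963, §2;
Kosinski VI.1): given oriented nonempty closed smooth `n`-manifolds, `n ≠ 0`, there is a closed
oriented `n`-manifold which is their oriented connected sum (precompose one disc with a reflection
to make it orientation reversing). For `n = 0` an orientation-reversing disc `𝔼 0 → N` need not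
exist, whence the hypothesis. [cite: KervaireMilnor1963, §2] -/
def exists_isOrientedConnectedSum : Prop :=
  ∀ (hn : n ≠ 0) (M N : Type u) [TopologicalSpace M] [T2Space M] [SecondCountableTopology M] [ChartedSpace (𝔼 n) M] [IsManifold (𝓡 n) ∞ M] [CompactSpace M] [Nonempty M] [TopologicalSpace N] [T2Space N] [SecondCountableTopology N] [ChartedSpace (𝔼 n) N] [IsManifold (𝓡 n) ∞ N] [CompactSpace N] [Nonempty N] (oM : SmoothOrientation (𝓡 n) M) (oN : SmoothOrientation (𝓡 n) N),
    ∃ (P : Type u) (_ : TopologicalSpace P) (_ : T2Space P) (_ : SecondCountableTopology P)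
      (_ : ChartedSpace (𝔼 n) P) (_ : IsManifold (𝓡 n) ∞ P) (_ : CompactSpace P)
      (oP : SmoothOrientation (𝓡 n) P), IsOrientedConnectedSum oM oN oP

/-- **`M # 𝕊ⁿ ≅ M`** in relational form: a smooth `n`-manifold `M` (nonempty, so that a disc
`i₁ : 𝔼 n → M` exists) is itself a connected sum of `M` and the sphere `𝕊ⁿ`: take for `i₂` the
inverse stereographic projection, so that `𝕊ⁿ ∖ i₂ (ball 0 1)` is a closed disc filling the hole
`i₁ (ball 0 1)` back in (Kervaire–Milnor 1963, §2, "`Sⁿ` serves as identity"; Kosinski,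
*Differential Manifolds*, VI.1.3). Stated only for `M` modelled on `𝓡 n` — for other models of
dimension `n` (products, boundary) the third slot `P := M` would not even have the model `𝔼 n` of
the discs (outline review #14). [cite: KervaireMilnor1963, §2  " Sⁿ  serves as identity"] -/
def isConnectedSum_sphere_self : Prop :=
  ∀ (M : Type*) [TopologicalSpace M] [T2Space M] [ChartedSpace (𝔼 n) M] [IsManifold (𝓡 n) ∞ M] [Nonempty M],
    IsConnectedSum (𝓡 n) (𝓡 n) (𝓡 n) M (𝕊 n) M

end Euclidean

/-! ### Topological properties of connected sums (sorried, known results) -/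

section Topology

variable {EP HP : Type*} [NormedAddCommGroup EP] [NormedSpace ℝ EP] [TopologicalSpace HP]
  {IP : ModelWithCorners ℝ EP HP}
  {EM HM : Type*} [NormedAddCommGroup EM] [NormedSpace ℝ EM] [TopologicalSpace HM]
  {IM : ModelWithCorners ℝ EM HM}
  {EN HN : Type*} [NormedAddCommGroup EN] [NormedSpace ℝ EN] [TopologicalSpace HN]
  {IN : ModelWithCorners ℝ EN HN}
  {M N P : Type*} [TopologicalSpace M] [T2Space M] [ChartedSpace HM M]
  [TopologicalSpace N] [T2Space N] [ChartedSpace HN N] [TopologicalSpace P] [ChartedSpace HP P]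

/-- A connected sum of compact manifolds is compact: `P` is the union of the images of the compact
sets `M ∖ i₁ (ball 0 2⁻¹)` and `N ∖ i₂ (ball 0 2⁻¹)` (the discs `i₁`, `i₂` are open maps, being
embeddings of manifolds of equal dimension as forced by the open embeddings `jA`, `jB`)
(Kervaire–Milnor 1963, §2; Kosinski, *Differential Manifolds*, VI.1). [cite: KervaireMilnor1963, §2] -/
def IsConnectedSum.compactSpace : Prop :=
  ∀ [CompactSpace M] [CompactSpace N] (h : IsConnectedSum IP IM IN M N P),
    CompactSpace P

/-- A connected sum of connected manifolds of dimension `≥ 2` is connected: `M ∖ {pt}` and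
`N ∖ {pt}` are connected and their images in `P` meet. The dimension hypothesis is necessary
(`ℝ # ℝ` is a disjoint union of two lines) (Kosinski, *Differential Manifolds*, VI.1). [cite: Kosinski1993, Ch. VI §1] -/
def IsConnectedSum.connectedSpace : Prop :=
  ∀ [ConnectedSpace M] [ConnectedSpace N] (h2 : 1 < finrank ℝ EP) (h : IsConnectedSum IP IM IN M N P),
    ConnectedSpace P

/-- A connected sum of simply connected manifolds of dimension `n ≥ 3` is simply connected
(Seifert–van Kampen: `M ∖ {pt}`, `N ∖ {pt}` are simply connected for `n ≥ 3` and the overlap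
`𝕊ⁿ⁻¹ × (0, 1)` is path connected for `n ≥ 2`) (Kosinski, *Differential Manifolds*, VI.1;
Hatcher, *Algebraic Topology*, Thm 1.20). [cite: Kosinski1993, Ch. VI §1] -/
def IsConnectedSum.simplyConnectedSpace : Prop :=
  ∀ [SimplyConnectedSpace M] [SimplyConnectedSpace N] (h3 : 2 < finrank ℝ EP) (h : IsConnectedSum IP IM IN M N P),
    SimplyConnectedSpace P

/-- A connected sum of nonempty manifolds along discs of positive dimension is nonempty: the
punctured piece `M ∖ {i₁ 0}` contains `i₁ u` for any `u ≠ 0` (Kervaire–Milnor 1963, §2). [cite: KervaireMilnor1963, §2] -/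
theorem IsConnectedSum.nonempty [Nontrivial EP] (h : IsConnectedSum IP IM IN M N P) :
    Nonempty P := by
  obtain ⟨i₁, i₂, h₁, -, jA, jB, -⟩ := h
  obtain ⟨u, hu⟩ := exists_ne (0 : EP)
  exact ⟨jA ⟨i₁ u, fun h => hu (h₁.isEmbedding.injective h)⟩⟩

end Topology

end Literature.Topology.FourManifolds
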